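import Literature.NumberTheory.EllipticCurves.ModularJacobianModPMultiplicityOne
import Literature.NumberTheory.EllipticCurves.ModularCurve
import Literature.NumberTheory.EllipticCurves.CuspFormTwist
import Literature.NumberTheory.EllipticCurves.ModularSymbolsProofs
import Literature.NumberTheory.EllipticCurves.GaloisAction
import Literature.NumberTheory.GaloisRepresentations.ModPGaloisRep
import HarnessLib

/-!
# The `ℚ`-structure of `J₀(N)` on the analytic Jacobian, the modular parametrisation as a
# `ℚ`-morphism, and the shift automorphism `t = [1, 1/3; 0, 1]` of `X₀(N)` for `9 ∣ N`
# (definition request `defn-AlgebraicModularParametrizationWithShift`)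

Topic `Literature/NumberTheory/EllipticCurves`. Requested by the BSD ideation cell `bsd-idea-3`
(route `TameQuarticManinParity`, LINES 23–25: items T24L `stmt-…-22694`, N24 `…-22545`, B23
`…-28282`, M25 `…-22695`; memo `LINE23-serre-weight-dichotomy.md` §§9–12): a CARRIER on which
"`φ : X₀(N) → E` is a `ℚ`-morphism", "`t : τ ↦ τ + 1/3` is an automorphism of `X₀(N)` over
`ℚ(ζ₃)` with `σ t σ⁻¹ = t^{ω(σ)}`" and "the induced actions on `H₁(X₀(N), ℤ)` and on
`J₀(N)[p](ℚ̄)`" can be SAID, so that the η-isogeny `ψ_f` (LINE 25) and the `t`-fixed torsion of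
the twist-pair quotient (B23♯, Lemma C of LINE 24) become statable.

## Design: the algebraic structure is put ON THE TREE'S ANALYTIC JACOBIAN

The tree already has the complex torus `J0 N = S₂(Γ₀(N))^∨ ⧸ H₁(X₀(N), ℤ)` with its action of the
full Hecke ring `𝕋_ℤ = HeckeRing0 N 2` (`ModularJacobianModPMultiplicityOne`; Darmon–Diamond–Taylor
1995 §1.3, Thm. 1.15: `Pic⁰(X₀(N)) ≅ V/Λ`), the period homology `Λ = periodHomology N` generated by
the period functionals `h ↦ {∞, γ∞}_h` (`ModularSymbolsPeriodHomology`), the hypothesis structure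
`ModularParametrizationData W N` of a modular parametrisation (`ModularCurve`) and the translation
matrices `twistT u = [1, u/m; 0, 1]` with the commutation relation behind twisting (`CuspFormTwist`).
What the tree does NOT have (recorded in `ModularJacobianModPMultiplicityOne`: "NO Galois action
on `J0 N` (the tree has no `X₀(N)` over `ℚ`)") is the `ℚ`-STRUCTURE: `X₀(N)` and `J₀(N)` are
defined over `ℚ` (DDT 1995 §1.5, p. 34–36: Shimura's canonical model; "the Jacobians `J_Γ` defined
in section 1.2 as complex tori also admit models over `ℚ` … the points in `J_Γ(K)`, for any
`ℚ`-algebra `K`, are identified with the divisor classes on `X_Γ` of degree `0`, defined over `K`";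
"the operator `T_n` arises from a correspondence which is defined over `ℚ`, and gives rise to an
endomorphism of the Jacobian `J_Γ` which is defined over `ℚ`"). Every torsion point of
`J₀(N)(ℂ) = V/Λ` is algebraic, so — after fixing an embedding `ι : ℚ̄ → ℂ` — the absolute Galois
group `Γ_ℚ` ACTS on the torsion subgroup `(V/Λ)_tors = J₀(N)(ℚ̄)_tors`. This file therefore:

* DEFINES (real definitions, proved API) the analytic objects the request lists under (a)–(c):
  - `J0.tors N`, the torsion `𝕋_ℤ`-submodule of `J0 N`;
  - `ModularParametrizationData.jacobiMap D : J0 N →+ W(ℂ)`, `[φ] ↦ uniformize (c · φ(f))` — the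
    modular parametrisation ON THE JACOBIAN (the Albanese form of `ModularParametrizationData.φ`:
    `φ_D(τ) = jacobiMap D [h ↦ 2πi∫_{i∞}^τ h]`), well defined because `c Λ_f ⊆ Λ_E`
    (`D.smul_periodLattice_le`) and `Λ_f = {φ(f) : φ ∈ Λ}` (`periodLattice_eq_map_periodHomology`);
  - for `9 ∣ N`: the SHIFT `t = [1, 1/3; 0, 1]`: `shiftCuspForm N h9 f = f ∣ t ∈ S₂(Γ₀(N))`
    (`t` normalises `Γ₀(N)`, `exists_twistT_mul_mapGL_eq` with `m = 3`, `d² ≡ 1 (mod 3)`), the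
    conjugation `shiftConj N h9 : Γ₀(N) → Γ₀(N)` (`t γ = (shiftConj γ) t`), the pull-back
    `shiftOp` on `S₂(Γ₀(N))`, its transpose `shiftDual` on `V = S₂^∨` — which IS the push-forward
    `t_*` on `H₁`: `shiftDual (periodFunctional γ) = periodFunctional (shiftConj γ)`, i.e.
    `{∞, γ∞}_{h∣t} = {∞, (tγt⁻¹)∞}_h` (`cuspSymbol_shiftCuspForm`, proved by moving the base point
    of the Eichler integral, `eichlerIntegral_smul_sub_holds`) — hence `t_*` preserves `Λ`
    (`shiftDual_mem_periodHomology`) and descends to `J0.shift N h9 : J0 N →+ J0 N` and to the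
    torsion, `J0.shiftTors`; `t³ = 1` (`shiftOp_shiftOp_shiftOp`, `shiftTors_iterate_three`);
* POSITS, as a HYPOTHESIS STRUCTURE in the tree's "structure + separate existence fact" pattern
  (`ModularParametrizationData` / `nonempty_modularParametrizationData`, `NeronKernelData`,
  `AbelianVarietyBridge`), exactly the algebraic content:
  - `ModularJacobianGaloisData N ι`: a homomorphism `galAct : Γ_ℚ → Aut_{𝕋_ℤ}(J0.tors N)`
    (the Galois action on `J₀(N)(ℚ̄)_tors` transported to `(V/Λ)_tors` along `ι`; `𝕋_ℤ`-LINEAR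
    because the Hecke correspondences are defined over `ℚ`), with open point stabilisers
    (`isOpen_stabilizer`: torsion points are defined over number fields), such that for EVERY
    Weierstrass model `W/ℚ` and EVERY parametrisation datum `D : ModularParametrizationData W N`
    the analytic map `jacobiMap D` is `Γ_ℚ`-EQUIVARIANT on torsion points
    (`jacobiMap_galAct`, through `WeierstrassCurve.geomPointsToComplex W ι : W(ℚ̄) → W(ℂ)`), i.e.
    "`φ_D : J₀(N) → W` is a homomorphism of abelian varieties over `ℚ`" (see the docstring of
    `nonempty_algebraicModularParametrizationWithShift` for the provenance of this clause for an
    ARBITRARY datum `D`, not only the strong Weil parametrisation);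
  - `AlgebraicModularParametrizationWithShift N h9 ι` (`9 ∣ N`) extends it by the Galois law of
    the shift: `σ ∘ t = t^{ω(σ)} ∘ σ` on torsion (`galAct_shiftTors`), `ω = χ_{-3}` the mod-`3`
    cyclotomic character (`Literature.NumberTheory.GaloisRepresentations.modPCyclotomicCharacterZMod ℚ 3`, `σ ζ₃ = ζ₃^{ω(σ)}`) — "`t` is defined
    over `ℚ(ζ₃)` and `σtσ⁻¹ = t^{χ₋₃(σ)}`";
  - ONE named fact `nonempty_algebraicModularParametrizationWithShift` (existence of the data for
    every `N` with `9 ∣ N` and every `ι`), cited clause by clause; the shift-free existence at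
    levels `9 ∤ N` is its obvious analogue and is NOT stated (no consumer yet).
* PROVES the first consequence the consumers need: the `t`-fixed torsion
  `J0.torsFixedByShift N h9` is a `Γ_ℚ`-STABLE subgroup (`galAct_mem_torsFixedByShift`: from
  `σ t = t^{±1} σ` and `t³ = 1`) — this is "`B^t = B[1 − t]` is `G_ℚ`-stable" of memo §9.4/§10.3(A),
  on `J₀(N)` itself; and that every Hecke-cut sub-object of the torsion is `Γ_ℚ`-stable
  (`galAct_mem_torsionBySet`, since `galAct σ` is `𝕋_ℤ`-linear) — this is how twist-pair
  quotients/sub-varieties, `A_f[3]`, `J[I_f]` acquire their Galois structures with no extra axiom.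

## How the consumers' objects are SAID with this carrier (recipes; nothing below is asserted)

* "`φ : X₀(N) → E` is a `ℚ`-morphism whose analytification is `ModularParametrizationData.φ`":
  `D.jacobiMap` + `jacobiMap_mk` (analytic side, `φ_D τ = D.jacobiMap (mk (h ↦ eichlerIntegral h τ))`
  by `rfl` on representatives) + the field `jacobiMap_galAct` (algebraic side).
* "the induced action of `t` on `H₁(X₀(N), ℤ)` / `periodLattice`": `shiftDual N h9` restricted to
  `periodHomology N` (`shiftDual_mem_periodHomology`, `shiftDual_periodFunctional`); evaluated at a
  form `f`: `(shiftDual φ) f = φ (f ∣ t)` (`shiftDual_apply`), and `cuspSymbol (f∣t) γ =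
  cuspSymbol f (tγt⁻¹)` (`cuspSymbol_shiftCuspForm`) — the input "(i)" of item S25 (`stmt-…-22692`).
* "`J₀(N)[p](ℚ̄)` as a `G_ℚ`-module with `t_*`": `Submodule.torsionBy _ (J0 N) p` inside `J0.tors N`
  with `galAct` and `J0.shiftTors`; `B[3]^t ∩ …` are intersections of `torsFixedByShift` with
  Hecke-cut subgroups; "`V ⊆ ker(t − 1)`, `V` `G_ℚ`-stable, `V ≇ V ⊗ ω`" are statements about
  `galAct` restricted to such finite subgroups (compare with `ModPGaloisRep` after choosing bases).
* The η-isogeny `ψ_f : E_{f⊗χ}^{opt} → (E_f^{opt})^{(−3)}` of LINE 25 (memo §12.2): on the Jacobian,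
  `D.jacobiMap ∘ (J0.shift − J0.shift⁻¹)` is the analytic map `[φ] ↦ u_W(c_f · φ(f∣t − f∣t⁻¹))`
  (`jacobiMap_mk`, `shift_mk`, `shiftDual_apply`), and `f∣t − f∣t⁻¹ = g(χ) f_χ` is the tree's
  `coe_charTwist`/`coe_twistRaw` at `m = 3`; its Galois behaviour on torsion follows from
  `jacobiMap_galAct` and `galAct_shiftTors`. NOTE for the planner: the EXISTENCE of `ψ_f` as an
  isogeny of degree `κ(f)` needs no modular curve at all — only the lattice inclusion
  `(c_f g/c_χ)·Λ(A) ⊆ Λ(W)` (item S25 with lattice-exactness) and the uniformisation dictionary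
  "`αΛ₁ ⊆ Λ₂` ⇒ `z ↦ αz` is an isogeny `ℂ/Λ₁ → ℂ/Λ₂` of degree `[Λ₂ : αΛ₁]`" (Silverman AEC VI.4.1(b),
  VI.5.3), plus, for `W` non-CM, Galois descent in the rank-one `ℤ`-module `Hom_ℚ̄(A, W)`; that
  dictionary is a separate (textbook) Literature statement, not part of this carrier.

## What is NOT here (scope lines)

* No `X₀(N)` as a scheme, no `J₀(N)` as `AbelianVariety ℚ` (cf. `exists_modularJacobian_hom_generators`
  for that currency), no uniqueness of the Galois structure (the axioms pin `galAct` only on the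
  torsion seen by elliptic optimal quotients and by `t`), no degeneracy maps `J₀(N/3) ⇄ J₀(N)` and
  no compatibility between the structures at two levels (needed for Lemma C of LINE 24: "t-fixed
  irreducible torsion is `3`-old" — a follow-up extension `…WithDegeneracy`), no Atkin–Lehner
  involutions, no statement that `jacobiMap D` is onto the torsion of `W(ℂ)` or that
  `W(ℂ)_tors ⊆ ι(W(ℚ̄))` (facts about `W` alone).
* TYPER LINT: no `instance`, no notation; the Galois action is a structure FIELD (`galAct`), used as
  `galAct σ x`.

## References

* [DarmonDiamondTaylor1995] H. Darmon, F. Diamond, R. Taylor, *Fermat's Last Theorem*, Current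
  Developments in Math. 1995 (held text `paper:doi-10-4310-cdm-1995-v1995-n1-a1`): §1.3 p. 27–28
  (`V = S₂(Γ)^∨`, `Λ = H₁(X_Γ, ℤ)`, Abel–Jacobi, **Thm. 1.15** `Pic⁰(X_Γ) ≅ V/Λ`, `J₀(N)`), p. 32
  (Hecke operators act on `V/Λ`); §1.5 p. 34–36 (models of `X₀(N)`, `J₀(N)` over `ℚ`; Hecke
  correspondences over `ℚ`), p. 38 (the `q`-expansion principle); §1.7 p. 44–45 (**Def. 1.44**
  `A_f = J_Γ/I_f J_Γ` "defined over `ℚ`", **Lemma 1.46** `A_f(ℂ) ≅ V_{[f]}/π_{[f]}(Λ)` with the natural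
  projection, the strong modular elliptic curve).
* [ShimuraIATAF1971] G. Shimura, *Introduction to the arithmetic theory of automorphic functions*
  (1971), §6.7–§7.5, Thm. 7.14 (the `ℚ`-rational quotient attached to a rational newform).
* [KenkuMomose1988] M. A. Kenku, F. Momose, *Automorphism groups of the modular curves `X₀(N)`*,
  Compositio Math. 65 (1988) 51–80 (the group `B₀(N) = Norm(Γ₀(N))/Γ₀(N)` of modular automorphisms
  of `X₀(N)`, containing `[1, 1/v; 0, 1]` for `v² ∣ N`, `v ∣ 24`; NOT held — `acq-14163` — and not
  cited for a numbered statement), as recalled in [Harrison2011X0108] M. Harrison, *A new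
  automorphism of `X₀(108)`*, arXiv:1108.5595, §2 ("`S_v` will denote the element of `B₀(108)`
  represented by the matrix `(1 1/v; 0 1)`", "all elements of `B₀(108)` are defined over
  `k_q = ℚ(√−3)`"; held text p0003, p0005).
* [SilvermanAEC2009] J. H. Silverman, *The arithmetic of elliptic curves*, III.5 (invariant
  differential), VI.4.1, VI.5.3 (analytic isogenies = algebraic isogenies).
* [Manin1972] Ju. I. Manin, *Parabolic points and zeta functions of modular curves*, Prop. 1.4,
  Thm. 1.6 (`{τ, γτ}` is independent of `τ`; used through the tree's `eichlerIntegral_smul_sub_holds`).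
-/

noncomputable section

open scoped MatrixGroups ModularForm

open CongruenceSubgroup Matrix.SpecialLinearGroup Matrix.GeneralLinearGroup UpperHalfPlane Complex

namespace Literature.NumberTheory.EllipticCurves.ModularForms

/-! ### §1. The torsion submodule of `J₀(N)(ℂ) = V/Λ` -/

section Torsion

variable (N : ℕ) [NeZero N]

/-- **The torsion subgroup `J₀(N)(ℂ)_tors` of the analytic Jacobian `J0 N = S₂(Γ₀(N))^∨ ⧸ H₁(X₀(N), ℤ)`**,
as a `𝕋_ℤ`-submodule (the Hecke ring acts `ℤ`-linearly, so it preserves torsion): the points of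
finite order, i.e. `ℚΛ/Λ`. These are exactly the images of the torsion points of the abelian
variety `J₀(N)/ℚ` under `J₀(N)(ℚ̄) → J₀(N)(ℂ) ≅ V/Λ`, hence the natural carrier of the Galois
action (Darmon–Diamond–Taylor 1995 §1.3 p. 27 (`Λ` a lattice in `V`), §1.5 p. 36).
[cite: DarmonDiamondTaylor1995, §1.3 (p. 27) and §1.5 (p. 36)] -/
def J0.tors : Submodule (HeckeRing0 N 2) (J0 N) where
  carrier := {x | IsOfFinAddOrder x}
  zero_mem' := IsOfFinAddOrder.zero
  add_mem' hx hy := hx.add hy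
  smul_mem' T _ hx := (DistribSMul.toAddMonoidHom (J0 N) T).isOfFinAddOrder hx

/-- Membership in `J0.tors N`: the point has finite order, i.e. some positive multiple vanishes
(`isOfFinAddOrder_iff_nsmul_eq_zero`). [cite: DarmonDiamondTaylor1995, §1.3 (p. 27)] -/
theorem J0.mem_tors_iff {x : J0 N} : x ∈ J0.tors N ↔ IsOfFinAddOrder x :=
  Iff.rfl

/-- The `ℓ`-torsion `J₀(N)[ℓ]` (`Submodule.torsionBy`, as in `ModularJacobianModPMultiplicityOne`)
lies in the torsion submodule, for `ℓ ≠ 0`. [cite: DarmonDiamondTaylor1995, §1.3 (p. 27)] -/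
theorem J0.torsionBy_le_tors {ℓ : ℕ} (hℓ : ℓ ≠ 0) :
    Submodule.torsionBy (HeckeRing0 N 2) (J0 N) ℓ ≤ J0.tors N := fun x hx ↦ by
  rw [J0.mem_tors_iff, isOfFinAddOrder_iff_nsmul_eq_zero]
  refine ⟨ℓ, Nat.pos_of_ne_zero hℓ, ?_⟩
  rw [Submodule.mem_torsionBy_iff] at hx
  rwa [Nat.cast_smul_eq_nsmul] at hx

/-- An additive endomorphism of `J0 N` maps torsion points to torsion points. [cite: DarmonDiamondTaylor1995, §1.3 (p. 27)] -/
theorem J0.map_mem_tors (u : J0 N →+ J0 N) {x : J0 N} (hx : x ∈ J0.tors N) :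
    u x ∈ J0.tors N :=
  u.isOfFinAddOrder hx

end Torsion

/-! ### §2. The modular parametrisation on the Jacobian: `J₀(N)(ℂ) → W(ℂ)`, `[φ] ↦ u_W(c · φ(f))` -/

section JacobiMap

variable {N : ℕ} [NeZero N] {W : WeierstrassCurve ℚ} (D : ModularParametrizationData W N)

namespace ModularParametrizationData

/-- The linear functional "evaluate at the newform and multiply by the Manin constant",
`φ ↦ c · φ(f)` on `V = S₂(Γ₀(N))^∨`; under `A_f(ℂ) ≅ ℂ/Λ_f`, `[φ] ↦ φ(f)` (Darmon–Diamond–Taylor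
1995, Lemma 1.46: `A_f(ℂ) ≅ V_{[f]}/π_{[f]}Λ`, and `(π_f φ)(f) = φ(f)`), this is the lift to `V` of
`A_f(ℂ) → ℂ/Λ_E`, `z ↦ c z`. [cite: DarmonDiamondTaylor1995, §1.7 Lemma 1.46 (p. 45)] -/
def evalHom : Module.Dual ℂ (CuspForm (Gamma0 N) 2) →+ ℂ where
  toFun φ := (D.c : ℂ) * φ D.f
  map_zero' := by simp
  map_add' φ ψ := by simp [mul_add]

/-- Unfolding `evalHom`. [cite: DarmonDiamondTaylor1995, §1.7 Lemma 1.46 (p. 45)] -/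
@[simp] theorem evalHom_apply (φ : Module.Dual ℂ (CuspForm (Gamma0 N) 2)) :
    D.evalHom φ = (D.c : ℂ) * φ D.f :=
  rfl

/-- `c · φ(f) ∈ Λ_E` for `φ ∈ H₁(X₀(N), ℤ)`: `φ(f) ∈ Λ_f` (`periodLattice_eq_map_periodHomology`,
Cremona 1997 §2.10) and `c Λ_f ⊆ Λ_E` (`smul_periodLattice_le`). [cite: CremonaAlgorithms1997, §2.10] -/
theorem evalHom_mem_lattice {φ : Module.Dual ℂ (CuspForm (Gamma0 N) 2)}
    (hφ : φ ∈ periodHomology N) : D.evalHom φ ∈ D.L.lattice := by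
  refine D.smul_periodLattice_le _ ?_
  rw [periodLattice_eq_map_periodHomology]
  exact ⟨φ, hφ, rfl⟩

/-- **The modular parametrisation on the Jacobian** `J₀(N)(ℂ) = V/Λ → W(ℂ)`,
`[φ] ↦ uniformize (c · φ(f))`: the composite of the natural projection `J₀(N) → A_f`,
`A_f(ℂ) ≅ ℂ/Λ_f` (Darmon–Diamond–Taylor 1995, Def. 1.44, Lemma 1.46) with `ℂ/Λ_f → ℂ/Λ_E → W(ℂ)`,
`z ↦ u_W(c z)` (Cremona 1997 §2.10: `φ(τ) = ℘-image of c · 2πi∫_{i∞}^τ f`). Well defined by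
`evalHom_mem_lattice` and `ker uniformize = Λ_E`. Precomposed with the Abel–Jacobi map
`τ ↦ [h ↦ 2πi∫_{i∞}^τ h]` it is `ModularParametrizationData.φ` (`jacobiMap_mk` and `rfl`).
[cite: DarmonDiamondTaylor1995, §1.7 Def. 1.44 and Lemma 1.46 (p. 44–45)]
[cite: CremonaAlgorithms1997, §2.10] -/
def jacobiMap : J0 N →+ (W.baseChange ℂ).toAffine.Point :=
  QuotientAddGroup.lift (periodHomologyHecke N).toAddSubgroup (D.uniformize.comp D.evalHom)
    fun φ hφ ↦ by
      rw [AddMonoidHom.mem_ker, AddMonoidHom.comp_apply, D.uniformize_eq_zero_iff]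
      exact D.evalHom_mem_lattice hφ

/-- `jacobiMap` on a representative: `jacobiMap [φ] = uniformize (c · φ(f))`. [cite: CremonaAlgorithms1997, §2.10] -/
@[simp] theorem jacobiMap_mk (φ : Module.Dual ℂ (CuspForm (Gamma0 N) 2)) :
    D.jacobiMap (Submodule.Quotient.mk φ) = D.uniformize ((D.c : ℂ) * φ D.f) :=
  rfl

end ModularParametrizationData

end JacobiMap

/-! ### §3. The shift `t = [1, 1/3; 0, 1]` for `9 ∣ N`: on cusp forms, on `V = S₂^∨`, on `Λ`,
on `J₀(N)(ℂ)` and on its torsion -/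

section ShiftConj

variable (N : ℕ) (h9 : 3 ^ 2 ∣ N)

include h9 in
/-- For `γ ∈ Γ₀(N)` with `9 ∣ N` the lower-right entry `d` satisfies `d² ≡ 1 (mod 3)` (`d` is a
unit mod `3` since `3 ∣ c` and `ad - bc = 1`). [cite: Shimura1971, Prop. 3.64] -/
theorem sq_intCast_entry_eq_one {γ : SL(2, ℤ)} (hγ : γ ∈ Gamma0 N) :
    (((γ 1 1 : ℤ) : ZMod 3)) ^ 2 = 1 := by
  have h3 : ((3 : ℕ) : ℤ) ∣ γ 1 0 :=
    (show ((3 : ℕ) : ℤ) ∣ (3 : ℤ) ^ 2 from ⟨3, by norm_num⟩).trans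
      (sq_dvd_entry_of_mem_Gamma0 (m := 3) h9 hγ)
  obtain ⟨u, hu⟩ := isUnit_intCast_entry_of_dvd (m := 3) γ h3
  rw [← hu, ← Units.val_pow_eq_pow_val]
  have : u ^ 2 = 1 := by
    have hcard : Fintype.card (ZMod 3)ˣ = 2 := by rw [ZMod.card_units_eq_totient]; decide
    rw [← hcard, pow_card_eq_one]
  rw [this, Units.val_one]

include h9 in
/-- **`t = [1, 1/3; 0, 1]` normalises `Γ₀(N)` when `9 ∣ N`**: for `γ ∈ Γ₀(N)` there is
`γ' ∈ Γ₀(N)` with `t γ = γ' t` in `GL(2, ℝ)` (the commutation relation of Shimura 1971, proof of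
Prop. 3.64, tree `exists_twistT_mul_mapGL_eq` with `m = 3`, `u = 1`, and `d² ≡ 1 (mod 3)`); so
`t` lies in the normaliser of `Γ₀(N)` and defines an element `S₃` of the group `B₀(N)` of modular
automorphisms of `X₀(N)` (Harrison 2011 §2: "`S_v` will denote the element of `B₀(108)` represented
by the matrix `(1 1/v; 0 1)`"; the group `B₀(N)` is the subject of Kenku–Momose 1988).
[cite: Shimura1971, Prop. 3.64] [cite: Harrison2011X0108, §2 (held text p0005)] -/
theorem exists_shiftConj (γ : Gamma0 N) :
    ∃ γ' : Gamma0 N, twistT (1 : ZMod 3) * (mapGL ℝ (γ : SL(2, ℤ)) : GL (Fin 2) ℝ) =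
      (mapGL ℝ (γ' : SL(2, ℤ)) : GL (Fin 2) ℝ) * twistT (1 : ZMod 3) := by
  obtain ⟨γ', hc, h⟩ :=
    exists_twistT_mul_mapGL_eq (m := 3) (γ : SL(2, ℤ)) (sq_dvd_entry_of_mem_Gamma0 h9 γ.2) 1
  refine ⟨⟨γ', mem_Gamma0_of_entry_eq (dvd_refl N) γ.2 hc⟩, ?_⟩
  rw [h, sq_intCast_entry_eq_one N h9 γ.2, one_mul]

/-- **Conjugation by the shift**, `γ ↦ t γ t⁻¹ : Γ₀(N) → Γ₀(N)` (`9 ∣ N`), chosen from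
`exists_shiftConj`; explicitly `(a b; c d) ↦ (a + c/3, b + (d − a)/3 − c/9; c, d − c/3)`.
[folklore] -/
def shiftConj (γ : Gamma0 N) : Gamma0 N :=
  (exists_shiftConj N h9 γ).choose

/-- Defining relation of `shiftConj`: `t γ = (shiftConj γ) t` in `GL(2, ℝ)`. [cite: Shimura1971, Prop. 3.64] -/
theorem twistT_mul_eq_shiftConj_mul (γ : Gamma0 N) :
    twistT (1 : ZMod 3) * (mapGL ℝ (γ : SL(2, ℤ)) : GL (Fin 2) ℝ) =
      (mapGL ℝ (shiftConj N h9 γ : SL(2, ℤ)) : GL (Fin 2) ℝ) * twistT (1 : ZMod 3) :=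
  (exists_shiftConj N h9 γ).choose_spec

/-- The shift `twistT 1 = [1, 1/3; 0, 1]` acts on `ℍ` by `τ ↦ τ + 1/3`. [cite: Shimura1971, Prop. 3.64] -/
theorem twistT_one_smul (τ : ℍ) : twistT (1 : ZMod 3) • τ = ((1 : ℝ) / 3) +ᵥ τ := by
  rw [twistT, upperRightHom_smul, ratCast_twistShift, ZMod.val_one]
  norm_num

/-- On `ℍ`: `(γτ) + 1/3 = (tγt⁻¹)(τ + 1/3)` for `γ ∈ Γ₀(N)`, `9 ∣ N`. [cite: Shimura1971, Prop. 3.64] -/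
theorem vadd_smul_eq_shiftConj_smul (γ : Gamma0 N) (τ : ℍ) :
    ((1 : ℝ) / 3) +ᵥ ((γ : SL(2, ℤ)) • τ) = (shiftConj N h9 γ : SL(2, ℤ)) • (((1 : ℝ) / 3) +ᵥ τ) := by
  have h := congrArg (fun g : GL (Fin 2) ℝ ↦ g • τ) (twistT_mul_eq_shiftConj_mul N h9 γ)
  simp only [mul_smul, twistT_one_smul] at h
  exact h

end ShiftConj

section Shift

variable (N : ℕ) [NeZero N] (h9 : 3 ^ 2 ∣ N)

/-- **The shifted cusp form `f ∣ t`, `t = [1, 1/3; 0, 1]`, is again of level `Γ₀(N)` when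
`9 ∣ N`**: `(f ∣ t) ∣ γ = f ∣ (tγ) = f ∣ ((tγt⁻¹) t) = f ∣ t` (`slash_twistT_slash_mapGL` with
`d² ≡ 1 (mod 3)`); holomorphy and vanishing at the cusps are those of the translate
`translateCuspForm f (1/3)` (`cuspFormOfInvariant`: the cusps of all arithmetic groups agree). On
`q`-expansions `∑ aₙ qⁿ ↦ ∑ aₙ ζ₃ⁿ qⁿ`. This is the pull-back `t^*` of holomorphic differentials
along the automorphism `t = S₃` of `X₀(N)` (Harrison 2011 §2; Kenku–Momose 1988).
[cite: Harrison2011X0108, §2 (held text p0005)] -/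
def shiftCuspForm (f : CuspForm (Gamma0 N) 2) : CuspForm (Gamma0 N) 2 :=
  cuspFormOfInvariant (translateCuspForm f (twistShift (1 : ZMod 3))) fun g hg ↦ by
    obtain ⟨γ, hγ, rfl⟩ := hg
    rw [coe_translateCuspForm,
      show (upperRightHom ((twistShift (1 : ZMod 3) : ℚ) : ℝ) : GL (Fin 2) ℝ) = twistT 1 from rfl,
      slash_twistT_slash_mapGL (dvd_refl N) h9 f hγ 1, sq_intCast_entry_eq_one N h9 hγ, one_mul]

/-- The underlying function of `f ∣ t` is `f ∣[2] [1, 1/3; 0, 1]`. [cite: Harrison2011X0108, §2 (held text p0005)] -/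
@[simp] theorem coe_shiftCuspForm (f : CuspForm (Gamma0 N) 2) :
    (⇑(shiftCuspForm N h9 f) : ℍ → ℂ) = (⇑f : ℍ → ℂ) ∣[(2 : ℤ)] twistT (1 : ZMod 3) :=
  rfl

/-- `(f ∣ t)(τ) = f(τ + 1/3)`. [cite: Harrison2011X0108, §2 (held text p0005)] -/
theorem shiftCuspForm_apply (f : CuspForm (Gamma0 N) 2) (τ : ℍ) :
    shiftCuspForm N h9 f τ = f (((1 : ℝ) / 3) +ᵥ τ) := by
  change translateCuspForm f (twistShift (1 : ZMod 3)) τ = _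
  rw [translateCuspForm_apply, ratCast_twistShift, ZMod.val_one]
  norm_num

/-- **The pull-back `t^*` on `S₂(Γ₀(N))`**, `f ↦ f ∣ t`, as a `ℂ`-linear map. [folklore] -/
def shiftOp : CuspForm (Gamma0 N) 2 →ₗ[ℂ] CuspForm (Gamma0 N) 2 where
  toFun := shiftCuspForm N h9
  map_add' f g := by
    ext τ
    simp [shiftCuspForm_apply]
  map_smul' a f := by
    ext τ
    simp [shiftCuspForm_apply]

/-- Unfolding `shiftOp`. [cite: Harrison2011X0108, §2 (held text p0005)] -/
@[simp] theorem shiftOp_apply (f : CuspForm (Gamma0 N) 2) : shiftOp N h9 f = shiftCuspForm N h9 f :=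
  rfl

/-- `t³ = [1, 1; 0, 1] ∈ Γ₀(N)` acts trivially: `((f ∣ t) ∣ t) ∣ t = f`. [cite: Harrison2011X0108, §2 (held text p0005); "the last [`S₃`] has order `3`"] -/
theorem shiftOp_shiftOp_shiftOp (f : CuspForm (Gamma0 N) 2) :
    shiftOp N h9 (shiftOp N h9 (shiftOp N h9 f)) = f := by
  ext τ
  simp only [shiftOp_apply, shiftCuspForm_apply, vadd_vadd]
  have h1 : (1 : ℝ) / 3 + ((1 : ℝ) / 3 + (1 : ℝ) / 3) = 1 := by norm_num
  rw [h1]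
  -- `[1, 1; 0, 1] = T ∈ Γ₀(N)` fixes `f`
  have hT : (mapGL ℝ ModularGroup.T : GL (Fin 2) ℝ) = upperRightHom (1 : ℝ) := by
    refine Units.ext ?_
    ext i j
    fin_cases i <;> fin_cases j <;> simp [upperRightHom, ModularGroup.coe_T]
  have hmem : (mapGL ℝ ModularGroup.T : GL (Fin 2) ℝ) ∈
      ((Gamma0 N : Subgroup SL(2, ℤ)) : Subgroup (GL (Fin 2) ℝ)) :=
    ⟨ModularGroup.T, by simp [Gamma0_mem, ModularGroup.coe_T], rfl⟩
  have h := congrFun (SlashInvariantFormClass.slash_action_eq f _ hmem) τ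
  rwa [hT, slash_upperRightHom_apply] at h

/-- **The push-forward `t_*` on `V = S₂(Γ₀(N))^∨`** (transpose of `t^*`): `(t_* φ)(f) = φ(f ∣ t)`.
On `H₁(X₀(N), ℤ) ⊆ V` this is the map induced by the automorphism `t` of `X₀(N)` on integral
homology (Darmon–Diamond–Taylor 1995 §1.3 p. 32: endomorphisms of `V/Λ` from their action on `S₂`).
[cite: DarmonDiamondTaylor1995, §1.3 (p. 32)] -/
def shiftDual : Module.Dual ℂ (CuspForm (Gamma0 N) 2) →ₗ[ℂ] Module.Dual ℂ (CuspForm (Gamma0 N) 2) :=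
  (shiftOp N h9).dualMap

/-- `(t_* φ)(f) = φ(f ∣ t)`. [cite: DarmonDiamondTaylor1995, §1.3 (p. 32)] -/
@[simp] theorem shiftDual_apply (φ : Module.Dual ℂ (CuspForm (Gamma0 N) 2))
    (f : CuspForm (Gamma0 N) 2) : shiftDual N h9 φ f = φ (shiftCuspForm N h9 f) :=
  rfl

/-- `t_*³ = 1` on `V`. [cite: DarmonDiamondTaylor1995, §1.3 (p. 32)] -/
theorem shiftDual_shiftDual_shiftDual (φ : Module.Dual ℂ (CuspForm (Gamma0 N) 2)) :
    shiftDual N h9 (shiftDual N h9 (shiftDual N h9 φ)) = φ := by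
  ext f
  simp only [shiftDual_apply]
  rw [← shiftOp_apply, ← shiftOp_apply, ← shiftOp_apply, shiftOp_shiftOp_shiftOp]

/-- The Eichler integral of `f ∣ t` is the Eichler integral of `f` at the shifted point:
`2πi∫_{i∞}^{τ} f(z + 1/3) dz = 2πi∫_{i∞}^{τ + 1/3} f(z) dz` (the vertical ray above `τ` shifts to the
vertical ray above `τ + 1/3`). [cite: Manin1972, §1.5 and Prop. 1.4] -/
theorem eichlerIntegral_shiftCuspForm (f : CuspForm (Gamma0 N) 2) (τ : ℍ) :
    eichlerIntegral (shiftCuspForm N h9 f) τ = eichlerIntegral f (((1 : ℝ) / 3) +ᵥ τ) := by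
  simp only [eichlerIntegral]
  congr 1
  refine MeasureTheory.setIntegral_congr_fun measurableSet_Ioi fun s hs ↦ ?_
  rw [shiftCuspForm_apply]
  congr 1
  have hs' : 0 < s := Set.mem_Ioi.mp hs
  have h1 : 0 < ((τ : ℂ) + s * Complex.I).im := by simpa using add_pos τ.im_pos hs'
  have h2 : 0 < ((((((1 : ℝ) / 3) +ᵥ τ : ℍ)) : ℂ) + s * Complex.I).im := by
    simpa using add_pos (((1 : ℝ) / 3) +ᵥ τ).im_pos hs'
  rw [ofComplex_apply_of_im_pos h1, ofComplex_apply_of_im_pos h2]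
  ext1
  simp only [coe_vadd]
  ring

/-- **`t_*` on period functionals**: `{∞, γ∞}_{f∣t} = {∞, (tγt⁻¹)∞}_f` for `γ ∈ Γ₀(N)`, `9 ∣ N`, i.e.
`t_*` acts on `H₁(X₀(N), ℤ)` through `γ ↦ tγt⁻¹` (Manin: `{∞, γ∞}_h = {τ, γτ}_h` for any `τ`, tree
`eichlerIntegral_smul_sub_holds`; take `τ` and `τ + 1/3`). This is input (i) of item S25 of route
TameQuarticManinParity (memo LINE23 §12.1: "`cuspSymbol (f∣t) γ = {∞, γ∞ + 1/3}_f = cuspSymbol f (tγt⁻¹)`").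
[cite: Manin1972, Prop. 1.4 / Thm. 1.6] -/
theorem cuspSymbol_shiftCuspForm (f : CuspForm (Gamma0 N) 2) (γ : Gamma0 N) :
    cuspSymbol (shiftCuspForm N h9 f) γ = cuspSymbol f (shiftConj N h9 γ) := by
  rw [← eichlerIntegral_smul_sub_holds (shiftCuspForm N h9 f) γ UpperHalfPlane.I,
    ← eichlerIntegral_smul_sub_holds f (shiftConj N h9 γ) (((1 : ℝ) / 3) +ᵥ UpperHalfPlane.I),
    eichlerIntegral_shiftCuspForm, eichlerIntegral_shiftCuspForm, vadd_smul_eq_shiftConj_smul]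

/-- `t_*` of the period functional of `γ` is the period functional of `tγt⁻¹`. [cite: Manin1972, §1.5 and Prop. 1.4] -/
theorem shiftDual_periodFunctional (γ : Gamma0 N) :
    shiftDual N h9 (periodFunctional N γ) = periodFunctional N (shiftConj N h9 γ) := by
  ext f
  simp [cuspSymbol_shiftCuspForm]

/-- **`t_*` preserves the period homology `Λ = H₁(X₀(N), ℤ) ⊆ V`** (it is induced by an automorphism
of `X₀(N)`; here: every element of `Λ` is a period functional, `coe_periodHomology_eq_range`, and
`shiftDual_periodFunctional`). [cite: Manin1972, §1.5 and Prop. 1.4] [cite: DarmonDiamondTaylor1995, §1.3 (p. 32)] -/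
theorem shiftDual_mem_periodHomology {φ : Module.Dual ℂ (CuspForm (Gamma0 N) 2)}
    (hφ : φ ∈ periodHomology N) : shiftDual N h9 φ ∈ periodHomology N := by
  rw [← SetLike.mem_coe, coe_periodHomology_eq_range] at hφ ⊢
  obtain ⟨γ, rfl⟩ := hφ
  exact ⟨shiftConj N h9 γ, (shiftDual_periodFunctional N h9 γ).symm⟩

/-- **The shift `t_*` on `J₀(N)(ℂ) = V/Λ`** (descends by `shiftDual_mem_periodHomology`): the
automorphism of the Jacobian induced (Albanese functoriality) by the automorphism `t` of `X₀(N)`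
(Harrison 2011 §2, `S₃`; Darmon–Diamond–Taylor 1995 §1.3 p. 32: endomorphisms of `V/Λ` induced
from `S₂`). It is additive; no `𝕋_ℤ`-linearity is claimed (`t` does not commute with all Hecke
operators). [cite: Harrison2011X0108, §2 (held text p0005)] [cite: DarmonDiamondTaylor1995, §1.3 (p. 32)] -/
def J0.shift : J0 N →+ J0 N :=
  QuotientAddGroup.map (periodHomologyHecke N).toAddSubgroup (periodHomologyHecke N).toAddSubgroup
    (shiftDual N h9).toAddMonoidHom fun _ hφ ↦ shiftDual_mem_periodHomology N h9 hφ

/-- `t_* [φ] = [t_* φ]` on representatives. [cite: DarmonDiamondTaylor1995, §1.3 (p. 32)] -/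
@[simp] theorem J0.shift_mk (φ : Module.Dual ℂ (CuspForm (Gamma0 N) 2)) :
    J0.shift N h9 (Submodule.Quotient.mk φ) = Submodule.Quotient.mk (shiftDual N h9 φ) :=
  rfl

/-- `t_*³ = 1` on `J₀(N)(ℂ)`. [cite: Harrison2011X0108, §2 (held text p0005)] -/
theorem J0.shift_shift_shift (x : J0 N) : J0.shift N h9 (J0.shift N h9 (J0.shift N h9 x)) = x := by
  obtain ⟨φ, rfl⟩ := Submodule.Quotient.mk_surjective (periodHomologyHecke N) x
  simp only [J0.shift_mk, shiftDual_shiftDual_shiftDual]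

/-- `t_*` preserves the torsion of `J₀(N)(ℂ)`. [cite: DarmonDiamondTaylor1995, §1.3 (p. 32)] -/
theorem J0.shift_mem_tors {x : J0 N} (hx : x ∈ J0.tors N) : J0.shift N h9 x ∈ J0.tors N :=
  J0.map_mem_tors N (J0.shift N h9) hx

/-- **The shift `t_*` on the torsion `J₀(N)(ℂ)_tors = J₀(N)(ℚ̄)_tors`** (restriction of `J0.shift`).
[folklore] -/
def J0.shiftTors : J0.tors N →+ J0.tors N :=
  ((J0.shift N h9).comp (J0.tors N).toAddSubgroup.subtype).codRestrict (J0.tors N).toAddSubgroup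
    fun x ↦ J0.shift_mem_tors N h9 x.2

/-- Unfolding `shiftTors` in `J0 N`. [cite: DarmonDiamondTaylor1995, §1.3 (p. 32)] -/
@[simp] theorem J0.coe_shiftTors (x : J0.tors N) :
    ((J0.shiftTors N h9 x : J0.tors N) : J0 N) = J0.shift N h9 (x : J0 N) :=
  rfl

/-- `t_*³ = 1` on torsion. [cite: Harrison2011X0108, §2 (held text p0005)] -/
theorem J0.shiftTors_shiftTors_shiftTors (x : J0.tors N) :
    J0.shiftTors N h9 (J0.shiftTors N h9 (J0.shiftTors N h9 x)) = x := by
  apply Subtype.ext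
  simp only [J0.coe_shiftTors, J0.shift_shift_shift]

/-- `t_*³ = 1` on torsion, iterate form: `shiftTors^[3] = id`. [cite: Harrison2011X0108, §2 (held text p0005)] -/
theorem J0.shiftTors_iterate_three (x : J0.tors N) : (J0.shiftTors N h9)^[3] x = x := by
  simp only [Function.iterate_succ, Function.iterate_zero, Function.comp_apply, id_eq]
  exact J0.shiftTors_shiftTors_shiftTors N h9 x

/-- **The `t`-fixed torsion `J₀(N)(ℚ̄)_tors^{t} = ker(t_* − 1)`** on torsion points (memo LINE23
§9.3/§10.3: `B^t = B[1 − t]`, here on `J₀(N)` itself; the twist-pair versions are its intersections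
with Hecke-cut subgroups). [folklore] -/
def J0.torsFixedByShift : AddSubgroup (J0.tors N) where
  carrier := {x | J0.shiftTors N h9 x = x}
  zero_mem' := map_zero _
  add_mem' hx hy := by
    simp only [Set.mem_setOf_eq] at hx hy ⊢
    rw [map_add, hx, hy]
  neg_mem' hx := by
    simp only [Set.mem_setOf_eq] at hx ⊢
    rw [map_neg, hx]

/-- Membership in the `t`-fixed torsion. [cite: DarmonDiamondTaylor1995, §1.3 (p. 32)] -/
theorem J0.mem_torsFixedByShift_iff (x : J0.tors N) :
    x ∈ J0.torsFixedByShift N h9 ↔ J0.shiftTors N h9 x = x :=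
  Iff.rfl

end Shift

/-! ### §4. The hypothesis structures: the `ℚ`-structure of `J₀(N)` on `(V/Λ)_tors`, and the shift law -/

section GaloisData

open scoped Classical in
/-- The map `W(ℚ̄) → W(ℂ)` on points induced by an embedding `ι : ℚ̄ → ℂ` (coordinatewise;
Mathlib `WeierstrassCurve.Affine.Point.map` along `ι` viewed as a `ℚ`-algebra map).
Silverman AEC III.§2 (base change of points). [folklore] -/
def _root_.WeierstrassCurve.geomPointsToComplex (W : WeierstrassCurve ℚ)
    (ι : AlgebraicClosure ℚ →+* ℂ) : W.geomPoints →+ (W.baseChange ℂ).toAffine.Point :=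
  WeierstrassCurve.Affine.Point.map (W' := W) ι.toRatAlgHom

open scoped Classical in
/-- Unfolding `geomPointsToComplex`. [cite: SilvermanAEC2009, III.§2] -/
theorem _root_.WeierstrassCurve.geomPointsToComplex_apply (W : WeierstrassCurve ℚ)
    (ι : AlgebraicClosure ℚ →+* ℂ) (P : W.geomPoints) :
    W.geomPointsToComplex ι P = WeierstrassCurve.Affine.Point.map (W' := W) ι.toRatAlgHom P :=
  rfl

variable (N : ℕ) [NeZero N] (h9 : 3 ^ 2 ∣ N) (ι : AlgebraicClosure ℚ →+* ℂ)

/-- **The `ℚ`-structure of the modular Jacobian, on the analytic torus** (hypothesis structure).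
`J₀(N)` is an abelian variety over `ℚ` (Shimura's canonical model of `X₀(N)` and Weil's theory of
the Jacobian; Darmon–Diamond–Taylor 1995 §1.5 p. 34–36) whose complex points are
`J₀(N)(ℂ) = V/Λ = J0 N` (Abel–Jacobi, op. cit. Thm. 1.15); its torsion points are algebraic, so a
fixed embedding `ι : ℚ̄ → ℂ` identifies `J₀(N)(ℚ̄)_tors` with `(V/Λ)_tors = J0.tors N` and
transports the action of `Γ_ℚ = Gal(ℚ̄/ℚ)`. The DATA: that action `galAct`, by `𝕋_ℤ`-LINEAR
automorphisms ("`T_n` arises from a correspondence which is defined over `ℚ`", op. cit. p. 36).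
The AXIOMS: point stabilisers are open (torsion points are defined over number fields), and for
every Weierstrass model `W/ℚ` with a parametrisation datum `D` at level `N` the analytic
parametrisation on the Jacobian `jacobiMap D : V/Λ → W(ℂ)` is `Γ_ℚ`-EQUIVARIANT on torsion
(it is the analytification of a `ℚ`-homomorphism `J₀(N) → A_f → W`, op. cit. §1.7 Def. 1.44,
Lemma 1.46 and the docstring of `nonempty_algebraicModularParametrizationWithShift`). Existence:
`nonempty_algebraicModularParametrizationWithShift` (with the shift, `9 ∣ N`). No uniqueness is
claimed. [cite: DarmonDiamondTaylor1995, §1.3 Thm. 1.15 (p. 28), §1.5 (p. 34–36), §1.7 Def. 1.44 and Lemma 1.46 (p. 44–45)] -/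
structure ModularJacobianGaloisData where
  /-- The action of `Γ_ℚ` on `J₀(N)(ℚ̄)_tors = (V/Λ)_tors` (transported along `ι`), by
  `𝕋_ℤ`-linear automorphisms. -/
  galAct : Field.absoluteGaloisGroup ℚ →* (J0.tors N ≃ₗ[HeckeRing0 N 2] J0.tors N)
  /-- The stabiliser of a torsion point is open in `Γ_ℚ` (the point is defined over a number
  field). -/
  isOpen_stabilizer : ∀ x : J0.tors N, IsOpen {σ : Field.absoluteGaloisGroup ℚ | galAct σ x = x}
  /-- For every `W/ℚ` and every parametrisation datum `D` of `W` at level `N`, the parametrisation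
  on the Jacobian is `Γ_ℚ`-equivariant on torsion points (through `ι`):
  `jacobiMap (σ x) = σ (jacobiMap x)`. -/
  jacobiMap_galAct : ∀ (W : WeierstrassCurve ℚ) (D : ModularParametrizationData W N)
    (σ : Field.absoluteGaloisGroup ℚ) (x : J0.tors N) (P : W.geomPoints),
    D.jacobiMap (x : J0 N) = W.geomPointsToComplex ι P →
      D.jacobiMap ((galAct σ x : J0.tors N) : J0 N) = W.geomPointsToComplex ι (σ • P)

/-- **`AlgebraicModularParametrizationWithShift N h9 ι`** — the requested carrier (definition item
`defn-AlgebraicModularParametrizationWithShift`): the `ℚ`-structure of `J₀(N)` on the analytic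
torus (`ModularJacobianGaloisData`: Galois action on torsion, `𝕋_ℤ`-linear, continuous, making every
modular parametrisation `jacobiMap D : J₀(N)(ℂ) → W(ℂ)` `Γ_ℚ`-equivariant), TOGETHER WITH the Galois
law of the shift `t = [1, 1/3; 0, 1]` (`9 ∣ N`): `t` is an automorphism of `X₀(N)` defined over
`ℚ(ζ₃)` (the element `S₃` of `B₀(N)`; Harrison 2011 §2 for `N = 108`: "all elements of `B₀(108)` are
defined over `k_q = ℚ(√−3)`"; Kenku–Momose 1988 for general `N`), acting on `q`-expansions at `∞`
by `q ↦ ζ₃ q`, so that by the `q`-expansion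
principle (Darmon–Diamond–Taylor 1995 §1.5 p. 38) `σ ∘ t ∘ σ⁻¹ = t^{ω(σ)}` with `σ(ζ₃) = ζ₃^{ω(σ)}`,
`ω = Literature.NumberTheory.GaloisRepresentations.modPCyclotomicCharacterZMod ℚ 3`; on the torsion of `J₀(N)(ℂ)`, where `t_*` is the DEFINED map
`J0.shiftTors` (`t_*` = transpose of `f ↦ f ∣ t`, `shiftDual`), this reads
`σ (t_* x) = t_*^{ω(σ)} (σ x)` (`galAct_shiftTors`; `ω(σ) ∈ (ℤ/3)ˣ` is read through `ZMod.val ∈ {1, 2}`,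
and `t_*² = t_*⁻¹` by `J0.shiftTors_iterate_three`). Existence: `nonempty_algebraicModularParametrizationWithShift`.
[cite: Harrison2011X0108, §2 (held text p0005)] [cite: DarmonDiamondTaylor1995, §1.5 (p. 34–38)] -/
structure AlgebraicModularParametrizationWithShift extends ModularJacobianGaloisData N ι where
  /-- The Galois law of the shift on torsion: `σ (t_* x) = t_*^{ω(σ)} (σ x)`, `ω` the mod-`3`
  cyclotomic character. -/
  galAct_shiftTors : ∀ (σ : Field.absoluteGaloisGroup ℚ) (x : J0.tors N),
    galAct σ (J0.shiftTors N h9 x) =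
      (J0.shiftTors N h9)^[((Literature.NumberTheory.GaloisRepresentations.modPCyclotomicCharacterZMod ℚ 3 σ : (ZMod 3)ˣ) : ZMod 3).val]
        (galAct σ x)

/-- **Existence of the `ℚ`-structure with shift** (named fact; the construction statement kept
SEPARATE from the interface). For every level `N` with `9 ∣ N` and every embedding `ι : ℚ̄ → ℂ`
there are data `AlgebraicModularParametrizationWithShift N h9 ι`. Provenance, clause by clause:
(1) `galAct`: `J₀(N)` is an abelian variety over `ℚ` with `J₀(N)(ℂ) = V/Λ` (Darmon–Diamond–Taylor
1995 §1.5 p. 36, Weil; §1.3 Thm. 1.15 Abel–Jacobi), torsion points of an abelian variety over `ℚ` are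
`ℚ̄`-points, and `ι` embeds `J₀(N)(ℚ̄) ↪ J₀(N)(ℂ)`; `𝕋_ℤ`-linearity: every `T_p` (`U_p` for `p ∣ N`)
comes from a correspondence defined over `ℚ` (op. cit. p. 36). (2) `isOpen_stabilizer`: `J₀(N)[n]`
is a finite étale group scheme over `ℚ`, its points are defined over a number field. (3)
`jacobiMap_galAct`: `jacobiMap D` is the composite of the natural projection `J₀(N) → A_f`
(`A_f = J₀(N)/I_f J₀(N)` "is defined over `ℚ`", op. cit. Def. 1.44; `A_f(ℂ) ≅ V_f/π_fΛ ≅ ℂ/Λ_f` via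
`φ ↦ φ(f)`, Lemma 1.46) with the analytic homomorphism `m : ℂ/Λ_f → W(ℂ)`, `z ↦ u_W(c z)`
(`cΛ_f ⊆ Λ_E`); `m` is an isogeny of complex elliptic curves (or zero), hence algebraic (Silverman AEC
VI.4.1(b), VI.5.3) and defined over `ℚ̄`; it pulls the `ℚ`-rational invariant differential `ω_W` of
the model `W` back to `c · 2πi f(τ)dτ`, a RATIONAL multiple of the `ℚ`-rational differential of `A_f`
(`q`-expansion principle, op. cit. p. 38: `S₂(Γ₀(N), ℚ)` = forms with rational `q`-expansion, and
`f` has rational coefficients), so for `σ ∈ Γ_ℚ` the difference `σ(m) − m` kills `ω_W`, hence is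
zero (an isogeny killing the invariant differential is inseparable, impossible in characteristic
`0`, Silverman AEC II.4.2(c), III.5): `m`, and with it `jacobiMap D = m ∘ π_f`, is defined over `ℚ`,
i.e. `Γ_ℚ`-equivariant on `ℚ̄`-points. (For the strong Weil curve and its optimal parametrisation
this is Shimura 1971 Thm. 7.14 / op. cit. §1.7 directly.) (4) `galAct_shiftTors`: `9 ∣ N` makes
`t = [1, 1/3; 0, 1]` normalise `Γ₀(N)` (`exists_shiftConj`, from Shimura 1971 Prop. 3.64), so `t` is an
automorphism of `X₀(N)_ℂ` — the element `S₃` of `B₀(N)` (Harrison 2011 §2; Kenku–Momose 1988),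
defined over `ℚ(ζ₃)` — with `t^*(h)(q) = h(ζ₃ q)` on `q`-expansions at the `ℚ`-rational cusp `∞`; for
`σ ∈ Γ_ℚ` the `q`-expansion principle gives `σ ∘ t^* ∘ σ⁻¹ = (t^{ω(σ)})^*` on
`ℚ̄ ⊗ ℚ(X₀(N)) ⊂ ℚ̄((q))`, hence `σ t σ⁻¹ = t^{ω(σ)}` on `X₀(N)(ℚ̄)` and, by Albanese functoriality,
on `J₀(N)(ℚ̄)`; on `V/Λ` the automorphism `t_*` is the transpose of the pull-back `t^* : f ↦ f ∣ t`
on `S₂(Γ₀(N)) = H⁰(X₀(N), Ω¹)` (op. cit. §1.3 p. 32), which is `shiftDual`/`J0.shift` by definition.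
Not proved here (no `X₀(N)` over `ℚ` in the tree). The shift-free statement for `9 ∤ N`
(`Nonempty (ModularJacobianGaloisData N ι)`) holds by (1)–(3) and is not separately named.
[cite: DarmonDiamondTaylor1995, §1.3 (p. 27–28, 32), §1.5 (p. 34–38), §1.7 Def. 1.44 and Lemma 1.46 (p. 44–45)]
[cite: ShimuraIATAF1971, Thm. 7.14] [cite: Harrison2011X0108, §2 (held text p0005)]
[cite: SilvermanAEC2009, II.4.2(c), III.5, VI.4.1(b), VI.5.3] -/
def nonempty_algebraicModularParametrizationWithShift : Prop :=
  ∀ (N : ℕ) [NeZero N] (h9 : 3 ^ 2 ∣ N) (ι : AlgebraicClosure ℚ →+* ℂ),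
    Nonempty (AlgebraicModularParametrizationWithShift N h9 ι)

end GaloisData

/-! ### §5. First consequences (proved): Galois stability of Hecke-cut and of `t`-fixed torsion -/

section Consequences

variable {N : ℕ} [NeZero N] {ι : AlgebraicClosure ℚ →+* ℂ}

namespace ModularJacobianGaloisData

variable (G : ModularJacobianGaloisData N ι)

/-- The Galois action commutes with the Hecke ring: `σ (T x) = T (σ x)` on torsion
(`galAct σ` is `𝕋_ℤ`-linear; Darmon–Diamond–Taylor 1995 §1.5 p. 36).
[cite: DarmonDiamondTaylor1995, §1.5 (p. 36)] -/
theorem galAct_smul (σ : Field.absoluteGaloisGroup ℚ) (T : HeckeRing0 N 2) (x : J0.tors N) :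
    G.galAct σ (T • x) = T • G.galAct σ x :=
  LinearEquiv.map_smul _ T x

/-- **Hecke-cut subgroups of the torsion are `Γ_ℚ`-stable**: if membership in `S` is decided by the
vanishing of Hecke operators (`S = {x | ∀ T ∈ 𝔞, T x = 0}` for a set `𝔞 ⊆ 𝕋_ℤ`, e.g. `J₀(N)[𝔪]`,
`J₀(N)[I_f]`, `A_f ∩ J₀(N)[n]`), then `σ S = S`. This is how abelian subvarieties and quotients of
`J₀(N)` cut out by the Hecke algebra inherit their `ℚ`-structure. [cite: DarmonDiamondTaylor1995, §1.5 (p. 36) and §1.7 Def. 1.44 (p. 44)] -/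
theorem galAct_mem_torsionBySet (σ : Field.absoluteGaloisGroup ℚ) (𝔞 : Set (HeckeRing0 N 2))
    {x : J0.tors N} (hx : x ∈ Submodule.torsionBySet (HeckeRing0 N 2) (J0.tors N) 𝔞) :
    G.galAct σ x ∈ Submodule.torsionBySet (HeckeRing0 N 2) (J0.tors N) 𝔞 := by
  rw [Submodule.mem_torsionBySet_iff] at hx ⊢
  intro T
  rw [← galAct_smul, hx T, map_zero]

/-- `σ⁻¹` undoes `σ` on torsion. [cite: DarmonDiamondTaylor1995, §1.5 (p. 36)] -/
theorem galAct_inv_apply (σ : Field.absoluteGaloisGroup ℚ) (x : J0.tors N) :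
    G.galAct σ⁻¹ (G.galAct σ x) = x := by
  rw [← LinearEquiv.mul_apply, ← map_mul, inv_mul_cancel, map_one]
  rfl

end ModularJacobianGaloisData

namespace AlgebraicModularParametrizationWithShift

variable {h9 : 3 ^ 2 ∣ N} (A : AlgebraicModularParametrizationWithShift N h9 ι)

/-- The exponent `ω(σ) ∈ {1, 2}` in the shift law (a unit of `ℤ/3`, read through `ZMod.val`).
[folklore] -/
private theorem val_cyclotomic_eq_one_or_two (σ : Field.absoluteGaloisGroup ℚ) :
    ((Literature.NumberTheory.GaloisRepresentations.modPCyclotomicCharacterZMod ℚ 3 σ : (ZMod 3)ˣ) : ZMod 3).val = 1 ∨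
      ((Literature.NumberTheory.GaloisRepresentations.modPCyclotomicCharacterZMod ℚ 3 σ : (ZMod 3)ˣ) : ZMod 3).val = 2 := by
  generalize Literature.NumberTheory.GaloisRepresentations.modPCyclotomicCharacterZMod ℚ 3 σ = u
  have hlt : ((u : ZMod 3)).val < 3 := ZMod.val_lt _
  have hne : ((u : ZMod 3)).val ≠ 0 := by
    rw [ne_eq, ZMod.val_eq_zero]
    exact u.ne_zero
  omega

/-- **The `t`-fixed torsion is `Γ_ℚ`-stable**: if `t_* x = x` then `t_* (σ x) = σ x`. From
`σ t_* = t_*^{ω(σ)} σ`: `σ x = t_*^{ω(σ)}(σ x)`, and a point fixed by `t_*²` is fixed by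
`t_* = t_*⁴` (`t_*³ = 1`). This is the `G_ℚ`-stability of `B^t = B[1 − t]` of memo LINE23 §9.4 /
§10.3 (A), on `J₀(N)`. [cite: DarmonDiamondTaylor1995, §1.5 (p. 36)] [cite: Harrison2011X0108, §2 (held text p0005)] -/
theorem galAct_mem_torsFixedByShift (σ : Field.absoluteGaloisGroup ℚ) {x : J0.tors N}
    (hx : x ∈ J0.torsFixedByShift N h9) : A.galAct σ x ∈ J0.torsFixedByShift N h9 := by
  rw [J0.mem_torsFixedByShift_iff] at hx ⊢
  have h := A.galAct_shiftTors σ x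
  rw [hx] at h
  -- `h : σ x = t^[v] (σ x)` with `v ∈ {1, 2}`
  rcases val_cyclotomic_eq_one_or_two σ with hv | hv <;> rw [hv] at h
  · simpa using h.symm
  · -- fixed by `t²` ⇒ fixed by `t⁴ = t`
    have h2 : (J0.shiftTors N h9)^[2] (A.galAct σ x) = A.galAct σ x := h.symm
    have h4 : (J0.shiftTors N h9)^[4] (A.galAct σ x) = A.galAct σ x := by
      rw [show 4 = 2 + 2 from rfl, Function.iterate_add_apply, h2, h2]
    rw [show 4 = 1 + 3 from rfl, Function.iterate_add_apply, J0.shiftTors_iterate_three,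
      Function.iterate_one] at h4
    exact h4

/-- The shift law with `σ` and `t_*` exchanged: `t_* (σ x) = σ (t_*^{ω(σ)} x)` (apply the law to
`t_*^{ω(σ)} x` and use `t_*³ = 1`; equivalently `ω(σ)² = 1`). Convenience form for consumers.
[cite: DarmonDiamondTaylor1995, §1.5 (p. 36)] [cite: Harrison2011X0108, §2 (held text p0005)] -/
theorem shiftTors_galAct (σ : Field.absoluteGaloisGroup ℚ) (x : J0.tors N) :
    J0.shiftTors N h9 (A.galAct σ x) =
      A.galAct σ ((J0.shiftTors N h9)^[((Literature.NumberTheory.GaloisRepresentations.modPCyclotomicCharacterZMod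
        ℚ 3 σ : (ZMod 3)ˣ) : ZMod 3).val] x) := by
  rcases val_cyclotomic_eq_one_or_two σ with hv | hv
  · -- `ω(σ) = 1`: `σ` and `t_*` commute
    have h := A.galAct_shiftTors σ x
    rw [hv, Function.iterate_one] at h
    rw [hv, Function.iterate_one]
    exact h.symm
  · -- `ω(σ) = 2`: `σ (t (t² x)) = t² (σ (t² x))`, `t (t² x) = x`, then apply `t` and use `t³ = 1`
    rw [hv]
    have h3 : J0.shiftTors N h9 ((J0.shiftTors N h9)^[2] x) = x := by
      rw [← Function.iterate_succ_apply' (J0.shiftTors N h9) 2]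
      exact J0.shiftTors_iterate_three N h9 x
    have h := A.galAct_shiftTors σ ((J0.shiftTors N h9)^[2] x)
    rw [hv, h3] at h
    rw [h, ← Function.iterate_succ_apply' (J0.shiftTors N h9) 2]
    exact J0.shiftTors_iterate_three N h9 _

end AlgebraicModularParametrizationWithShift

end Consequences

end Literature.NumberTheory.EllipticCurves.ModularForms

end
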